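import Summits.CriticalPhenomena.PercolationContinuityZ3.Theorems.PercNearOneGluingNoHeavyLowerTailSunflowerGradedMergeInduction

/-!
# `NoHeavyLowerTail` (crux stmt-CriticalPhenomena-4575), abstract sunflower cubic: the graded-safe class 𝒢₁⁺
# (disjoint disjunctions of members of 𝓛⁺)

Support file (seat `prim-ineq-prove-1` gen 35; `--supports stmt-CriticalPhenomena-4575`).  No `sorry`, no named facts.
Memo: run/shared/lean/prim/prim-ineq-prove-1/FINDING-LSM-prove1-g35.md §5.

* `GP` — disjunctions, on pairwise disjoint supports, of well-formed 𝓛⁺-formulas (`LP`); **`GP.gsafe`** / `GP.safe`: gradedly safe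
  (`LP.gsafe` + g34's `gsafe_union`), hence safe, for every `p` with `0 < p < 1` on the support.  Together with g34's `safe_inter` /
  `safe_union_of_gsafe` this certifies: every read-once core with ≤ 6 leaves is gradedly safe and every read-once core with ≤ 13
  leaves is safe (memo §5), for non-degenerate `p`.
-/

noncomputable section

namespace Summit.CriticalPhenomena.PercolationContinuityZ3.Theorems.SunflowerPartition

namespace SafeCalc

open MeasureTheory Finset
open Literature.Probability.LatticeModels Literature.Probability.Percolation

variable {ι : Type*} [DecidableEq ι] (p : ι → unitInterval)

/-- The class 𝒢₁⁺: members of 𝓛⁺ and their disjunctions on disjoint supports. [this work] -/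
inductive GP (ι : Type*) : Type _
  | base : LP ι → GP ι
  | or : GP ι → GP ι → GP ι

namespace GP

variable {p}

/-- Support. [this work] -/
def supp : GP ι → Finset ι
  | base F => F.supp
  | .or G H => G.supp ∪ H.supp

/-- Up-set. [this work] -/
def toSet : GP ι → Set (Set ι)
  | base F => F.toSet
  | .or G H => G.toSet ∪ H.toSet

/-- Well-formedness (read-once). [this work] -/
def WF : GP ι → Prop
  | base F => F.WF
  | .or G H => G.WF ∧ H.WF ∧ Disjoint G.supp H.supp

omit [DecidableEq ι] in
/-- Up-sets of 𝒢₁⁺-formulas are up-sets. [this work] -/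
theorem isUpperSet_toSet : ∀ G : GP ι, IsUpperSet G.toSet
  | base F => LP.isUpperSet_toSet F
  | .or G H => (isUpperSet_toSet G).union (isUpperSet_toSet H)

/-- Up-sets of 𝒢₁⁺-formulas are determined by their supports. [this work] -/
theorem determinedBy_toSet : ∀ G : GP ι, DeterminedBy G.toSet (↑G.supp : Set ι)
  | base F => LP.determinedBy_toSet F
  | .or G H => by
    have hG := (determinedBy_toSet G).mono (show (↑G.supp : Set ι) ⊆ ↑(G.supp ∪ H.supp) from
      Finset.coe_subset.2 subset_union_left)
    have hH := (determinedBy_toSet H).mono (show (↑H.supp : Set ι) ⊆ ↑(G.supp ∪ H.supp) from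
      Finset.coe_subset.2 subset_union_right)
    rw [determinedBy_iff] at hG hH ⊢
    intro ω ω' h
    exact or_congr (hG ω ω' h) (hH ω ω' h)

/-- **Every well-formed 𝒢₁⁺-formula defines a gradedly safe core** (non-degenerate `p`). [this work] -/
theorem gsafe [Fintype ι] : ∀ G : GP ι, G.WF → (∀ x ∈ G.supp, 0 < (p x : ℝ) ∧ (p x : ℝ) < 1) → GSafe p G.supp G.toSet
  | base F, h, hp => LP.gsafe p F h hp
  | .or G H, h, hp => gsafe_union p h.2.2 (determinedBy_toSet G) (determinedBy_toSet H)
      (gsafe G h.1 fun x hx => hp x (mem_union_left _ hx)) (gsafe H h.2.1 fun x hx => hp x (mem_union_right _ hx))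

/-- … hence a safe one (Lemma A, (C1-law), the H/G/T rows via `…SunflowerSafeCalculus`). [this work] -/
theorem safe [Fintype ι] (G : GP ι) (h : G.WF) (hp : ∀ x ∈ G.supp, 0 < (p x : ℝ) ∧ (p x : ℝ) < 1) : Safe p G.toSet :=
  safe_of_gsafe p G.supp (determinedBy_toSet G) (isUpperSet_toSet G) (gsafe G h hp)

end GP

end SafeCalc

end Summit.CriticalPhenomena.PercolationContinuityZ3.Theorems.SunflowerPartition
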